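import Mathlib
import Literature.NumberTheory.GaloisRepresentations.CrystallineOrdinaryShape
import Literature.NumberTheory.GaloisRepresentations.LocalKroneckerWeberInertiaProofs
import Literature.NumberTheory.GaloisRepresentations.ResidualPairIntegrality
import Literature.RepresentationTheory.Semisimple.BrauerNesbitt
import Literature.RepresentationTheory.Semisimple.Multiplicity
import Literature.NumberTheory.Automorphic.AdicCompletionLocalField
import Summits.Langlands.Langlands.Theorems.PhantomRMYoshidaStableYoshidaCongruenceCharpolyCongruence
import Literature.NumberTheory.Automorphic.GKModulesAdmissible
import HarnessLib

/-!
# Route `PhantomRMYoshida`, crux `StableYoshidaCongruence` (stmt-Langlands-13640), line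
# `level-three-weierstrass-switch`: Stub 1b `stub_distinguishedTransferLocal`

`p` odd, `v ∣ p` the place of `ℚ`, `red : 𝒪 = 𝒪_{ℚ̄_p} → k` a ring map to a field of characteristic
`p`, `r, r' : Γ_ℚ → GL₄(ℚ̄_p)` continuous with congruent characteristic polynomials everywhere
(conclusion of Stub 1a `stub_charpolyCongruence`).  If `r` is residually distinguished of shape
`(0,0,1,1)` at `v` and `r'` is Greenberg-ordinary of shape `(0,0,1,1)` at `v`
(`Literature/NumberTheory/GaloisRepresentations/CrystallineOrdinaryShape.lean`), then `r'` is
residually distinguished of shape `(0,0,1,1)` at `v`, in its Greenberg frame (registered signature).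

Proof.  `χ̄ᵢ = red ∘ χᵢ`, `ψ̄ᵢ = red ∘ ψᵢ : Γ_{ℚ_v} → kˣ` the residual diagonal characters of the
distinguished frame of `r|_{Γ_{ℚ_v}}` and of the Greenberg frame of `r'|_{Γ_{ℚ_v}}`
(`exists_redDiagChar`; values of norm one, `ker red = {‖x‖ < 1}` by Stub 1a's `red` lemmas, so
`‖χᵢ(τ) - χⱼ(τ)‖ = 1 ⟺ χ̄ᵢ(τ) ≠ χ̄ⱼ(τ)`).  (1) `∏ᵢ (X - χ̄ᵢ(τ)) = red det(X - r(τ)) =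
red det(X - r'(τ)) = ∏ᵢ (X - ψ̄ᵢ(τ))` for all `τ ∈ Γ_{ℚ_v}` (triangular charpoly, conjugation
invariance).  (2) So the semisimple diagonal `k`-representations `⊕ χ̄ᵢ`, `⊕ ψ̄ᵢ` are equivalent by
Brauer–Nesbitt (tree `Representation.nonempty_equiv_of_charpoly_eq`), and counting `Hom_Γ(η, ·)`
(tree `Representation.mult_pi`) gives `#{i | χ̄ᵢ = η} = #{i | ψ̄ᵢ = η}` for every `η`.
(3) `χ_p(I_{ℚ_v}) ∋ -1` (tree `adicCompletion_rat_exists_mem_absInertia_cyclotomicCharacter_eq`) gives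
`σ₀ ∈ I_{ℚ_v}` with `χ̄ᵢ(σ₀) = ψ̄ᵢ(σ₀) = (-1)^{aᵢ}`, `a = (0,0,1,1)`, `-1 ≠ 1` in `k`: indices `{0,1}`
and `{2,3}` never share a residual character.  (4) Hence `ψ̄₀ = ψ̄₁` would force `χ̄₀ = χ̄₁`; same
for `(2,3)`; these are the only pairs `i < j` with `aᵢ = aⱼ`.  Everything used is proved in the tree;
the file declares no definitions (one-dimensional representations are written as twists of the trivial
representation, tree `Representation.twist`, through a local notation).
References: Boxer–Calegari–Gee–Pilloni, Publ. IHÉS 134 (2021) §7.3; Bourbaki, *Algèbre* VIII §20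
n°6 Cor. 1; Serre, *Local Fields* IV §4 Prop. 17.
-/

-- `Summit.Langlands.Langlands.…` (summit = sub-problem name, D-0017 layout) trips `dupNamespace` on every decl.
set_option linter.dupNamespace false

noncomputable section

open Literature.NumberTheory.GaloisRepresentations Literature.NumberTheory.Automorphic
open Literature.RepresentationTheory.Semisimple
open IsDedekindDomain Filter Polynomial
open scoped NumberField

namespace Summit.Langlands.Langlands.Cruxes.StableYoshidaCongruence.LevelThreeWeierstrassSwitch

section RepTheory

variable {k : Type*} [Field k] {Γ : Type*} [Group Γ]

/-- `T[χ]`: the one-dimensional representation `x ↦ χ(g) x` of a character `χ : Γ → kˣ` on `k`, the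
twist of the trivial representation by `χ` (tree `Representation.twist`; local notation). [folklore] -/
local notation "T[" χ "]" => Representation.twist (Representation.trivial k Γ k) χ

/-- Values of `T[χ]`. [folklore] -/
theorem charRep_apply_apply (χ : Γ →* kˣ) (g : Γ) (x : k) : T[χ] g x = (χ g : k) * x := by
  simp

/-- `T[χ]` is irreducible. [folklore] -/
theorem charRep_isIrreducible (χ : Γ →* kˣ) : (T[χ]).IsIrreducible :=
  isIrreducible_of_finrank_eq_one' _ (Module.finrank_self k)

/-- The characteristic polynomial of `⊕ᵢ T[χᵢ]` (tree `Representation.pi`) at `g` is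
`∏ᵢ (X - χᵢ(g))`. [folklore] -/
theorem charpoly_diagRep {n : ℕ} (c : Fin n → Γ →* kˣ) (g : Γ) :
    (Representation.pi (fun i => T[c i]) g).charpoly = ∏ i, (X - C ((c i g : kˣ) : k)) := by
  classical
  have hM : LinearMap.toMatrix' (Representation.pi (fun i => T[c i]) g) =
      Matrix.diagonal fun i => ((c i g : kˣ) : k) := by
    ext i j
    rw [LinearMap.toMatrix'_apply, Representation.pi_apply_apply, charRep_apply_apply,
      Matrix.diagonal_apply]
    by_cases h : i = j
    · subst h; simp
    · rw [Pi.single_eq_of_ne h, mul_zero, if_neg h]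
  rw [← LinearMap.charpoly_toMatrix _ (Pi.basisFun k (Fin n)), LinearMap.toMatrix_eq_toMatrix', hM,
    Matrix.charpoly_diagonal]

/-- `[χ : η] ≤ 1` for characters (`Hom_Γ(η, χ) ⊆ End_k(k)`). [folklore] -/
theorem mult_charRep_le_one (η χ : Γ →* kˣ) : Representation.mult T[η] T[χ] ≤ 1 := by
  have h := LinearMap.finrank_le_finrank_of_injective
    (f := Representation.IntertwiningMap.toLinearMapl T[η] T[χ])
    (Representation.IntertwiningMap.toLinearMap_injective _ _)
  simpa [Representation.mult] using h

/-- `[χ : η] > 0 ↔ η = χ` for characters. [folklore] -/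
theorem mult_charRep_pos_iff (η χ : Γ →* kˣ) : 0 < Representation.mult T[η] T[χ] ↔ η = χ := by
  rw [Representation.mult_pos_iff]
  constructor
  · rintro ⟨f, hf⟩
    have h1 : f (1 : k) ≠ 0 := fun h0 =>
      hf (Representation.IntertwiningMap.ext (LinearMap.ext fun x => by
        have : f x = x * f 1 := by rw [← smul_eq_mul, ← map_smul, smul_eq_mul, mul_one]
        rw [Representation.IntertwiningMap.toLinearMap_apply, this, h0, mul_zero]; rfl))
    ext g
    have h := Representation.IntertwiningMap.isIntertwining T[η] T[χ] f g (1 : k)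
    simp only [charRep_apply_apply, mul_one] at h
    have h2 : f (η g : k) = (η g : k) * f 1 := by
      rw [← smul_eq_mul, ← map_smul, smul_eq_mul, mul_one]
    rw [h2] at h
    exact mul_right_cancel₀ h1 h
  · rintro rfl
    refine ⟨Representation.IntertwiningMap.id _, fun h => ?_⟩
    have := congrArg (fun f : Representation.IntertwiningMap T[η] T[η] => f (1 : k)) h
    simp at this

open Classical in
/-- Schur for characters over any field: `[χ : η] = 1` if `χ = η`, else `0`. [folklore] -/
theorem mult_charRep_eq (η χ : Γ →* kˣ) :
    Representation.mult T[η] T[χ] = if χ = η then 1 else 0 := by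
  split_ifs with h
  · have h1 := mult_charRep_le_one η χ; have h2 := (mult_charRep_pos_iff η χ).2 h.symm; omega
  · have h2 := mt (mult_charRep_pos_iff η χ).1 (Ne.symm h); omega

open Classical in
/-- `[⊕ᵢ χᵢ : η] = #{i | χᵢ = η}` (tree `Representation.mult_pi`). [folklore] -/
theorem mult_charRep_diagRep {n : ℕ} (η : Γ →* kˣ) (c : Fin n → Γ →* kˣ) :
    Representation.mult T[η] (Representation.pi fun i => T[c i]) =
      (Finset.univ.filter fun i => c i = η).card := by
  rw [Representation.mult_pi]
  simp only [mult_charRep_eq, Finset.sum_boole, Nat.cast_id]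

open Classical in
/-- **Multisets of characters from characteristic polynomials** (Brauer–Nesbitt for sums of
characters, any field, any group): if `∏ᵢ (X - aᵢ(g)) = ∏ᵢ (X - bᵢ(g))` for all `g`, then every
character `η` occurs among the `aᵢ` and among the `bᵢ` the same number of times (the diagonal
representations `⊕ T[aᵢ]`, `⊕ T[bᵢ]` are semisimple with equal characteristic polynomials, hence
equivalent, tree `Representation.nonempty_equiv_of_charpoly_eq`; then count `Hom_Γ(T[η], ·)`).
[cite: BourbakiAlgebreVIII2012, VIII § 20 n° 6, Thm. 2, Cor. 1 (p. 378)] -/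
theorem card_filter_eq_of_prod_X_sub_C_eq {n : ℕ} (a b : Fin n → Γ →* kˣ)
    (h : ∀ g, ∏ i, (X - C ((a i g : kˣ) : k)) = ∏ i, (X - C ((b i g : kˣ) : k))) (η : Γ →* kˣ) :
    (Finset.univ.filter fun i => a i = η).card = (Finset.univ.filter fun i => b i = η).card := by
  haveI : ∀ χ : Γ →* kˣ, (T[χ]).IsIrreducible := charRep_isIrreducible
  obtain ⟨e⟩ := Representation.nonempty_equiv_of_charpoly_eq (Representation.pi fun i => T[a i])
    (Representation.pi fun i => T[b i]) fun g => by rw [charpoly_diagRep, charpoly_diagRep, h g]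
  rw [← mult_charRep_diagRep, ← mult_charRep_diagRep, Representation.mult_congr_right _ e]

/-- The pairs `i < j` of equal weight in the shape `(0,0,1,1)` are `(0,1)` and `(2,3)`. [folklore] -/
theorem shape0011_eq_iff (i j : Fin 4) (hij : i < j) :
    (![0, 0, 1, 1] : Fin 4 → ℕ) i = ![0, 0, 1, 1] j ↔ i = 0 ∧ j = 1 ∨ i = 2 ∧ j = 3 := by
  revert i j
  decide

open Classical in
/-- **The combinatorial heart.**  Four characters `a₀,…,a₃` and four characters `b₀,…,b₃` of a
group with the same multiplicities (`#{i | aᵢ = η} = #{i | bᵢ = η}` for every `η`), taking at some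
`σ₀` the values `u^0, u^0, u^1, u^1` with `u ≠ 1` (so `{0,1}` and `{2,3}` cannot mix): if
`a₀ ≠ a₁` and `a₂ ≠ a₃` then `b₀ ≠ b₁` and `b₂ ≠ b₃`. [folklore] -/
theorem ne_and_ne_of_card_filter_eq (a b : Fin 4 → Γ →* kˣ)
    (hab : ∀ η : Γ →* kˣ,
      (Finset.univ.filter fun i => a i = η).card = (Finset.univ.filter fun i => b i = η).card)
    {σ₀ : Γ} {u : k} (hu : u ≠ 1)
    (ha : ∀ i, ((a i σ₀ : kˣ) : k) = u ^ (![0, 0, 1, 1] : Fin 4 → ℕ) i)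
    (hb : ∀ i, ((b i σ₀ : kˣ) : k) = u ^ (![0, 0, 1, 1] : Fin 4 → ℕ) i)
    (h01 : a 0 ≠ a 1) (h23 : a 2 ≠ a 3) : b 0 ≠ b 1 ∧ b 2 ≠ b 3 := by
  -- two equal `b`'s force two equal `a`'s with the same value
  have key : ∀ i₁ i₂ : Fin 4, i₁ ≠ i₂ → b i₁ = b i₂ →
      ∃ j₁ j₂ : Fin 4, j₁ ≠ j₂ ∧ a j₁ = b i₁ ∧ a j₂ = b i₁ := by
    intro i₁ i₂ hi hbi
    have h2 : 1 < (Finset.univ.filter fun i => a i = b i₁).card := by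
      rw [hab]
      calc 1 < ({i₁, i₂} : Finset (Fin 4)).card := by rw [Finset.card_pair hi]; exact one_lt_two
        _ ≤ _ := Finset.card_le_card (by
          intro x hx
          simp only [Finset.mem_insert, Finset.mem_singleton] at hx
          rcases hx with rfl | rfl <;> simp [hbi])
    obtain ⟨j₁, hj₁, j₂, hj₂, hne⟩ := Finset.one_lt_card.1 h2
    simp only [Finset.mem_filter, Finset.mem_univ, true_and] at hj₁ hj₂
    exact ⟨j₁, j₂, hne, hj₁, hj₂⟩
  -- values at `σ₀` sort indices into `{0,1}` and `{2,3}`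
  have hval : ∀ i j : Fin 4, a j = b i →
      u ^ (![0, 0, 1, 1] : Fin 4 → ℕ) j = u ^ (![0, 0, 1, 1] : Fin 4 → ℕ) i := by
    intro i j h
    rw [← ha, ← hb, h]
  constructor
  · intro hb01
    obtain ⟨j₁, j₂, hne, hj₁, hj₂⟩ := key 0 1 (by decide) hb01
    have e₁ := hval 0 j₁ hj₁
    have e₂ := hval 0 j₂ hj₂
    apply h01
    fin_cases j₁ <;> fin_cases j₂ <;> simp_all
  · intro hb23
    obtain ⟨j₁, j₂, hne, hj₁, hj₂⟩ := key 2 3 (by decide) hb23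
    have e₁ := hval 2 j₁ hj₁
    have e₂ := hval 2 j₂ hj₂
    apply h23
    fin_cases j₁ <;> fin_cases j₂ <;> simp_all

end RepTheory

section RedChar

variable {p : ℕ} [Fact p.Prime] {k : Type} [Field k]
variable {G : Type*} [Group G] [TopologicalSpace G] {n : ℕ}

/-- `red x = red y ↔ ‖x - y‖ < 1` (`ker red` is the maximal ideal of `𝒪_{ℚ̄_p}`). [folklore] -/
theorem red_eq_red_iff [CharP k p] (red : Valued.integer (PadicAlgCl p) →+* k)
    (x y : Valued.integer (PadicAlgCl p)) :
    red x = red y ↔ ‖(x : PadicAlgCl p) - y‖ < 1 := by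
  rw [← sub_eq_zero, ← map_sub]
  constructor
  · intro h
    simpa using norm_lt_one_of_red_eq_zero red h
  · intro h
    exact red_eq_zero_of_norm_lt_one red _ (by simpa using h)

/-- Change of frame does not change characteristic polynomials (Mathlib
`Matrix.charpoly_units_conj`; local copy of `FramedRep.charpoly_conj` of
`GlobalTriangulineSpace.lean`, not imported to keep the import cone small). [folklore] -/
private theorem charpoly_conj_aux {A : Type*} [CommRing A] [TopologicalSpace A] [IsTopologicalRing A]
    (P : GL (Fin n) A) (ρ : FramedRep G A n) (σ : G) :
    (ρ.conj P).charpoly σ = ρ.charpoly σ := by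
  simp only [FramedRep.charpoly, FramedRep.conj_apply, Units.val_mul, Matrix.coe_units_inv]
  exact Matrix.charpoly_units_conj P _

/-- **Residual diagonal characters of a triangular frame.**  For an upper triangular
`ρ : G →ₜ* GL_n(ℚ̄_p)` of a compact group (diagonal characters `χᵢ` with values of norm one,
`norm_diagEntry_eq_one`, i.e. in `𝒪`) and `red : 𝒪 → k` to a field of characteristic `p`, the
characters `χ̄ᵢ = red ∘ χᵢ : G → kˣ` satisfy: `χ̄ᵢ(g) = red x` whenever `x = χᵢ(g)`;
`χ̄ᵢ(g) ≠ χ̄ⱼ(g) ⟺ ‖χᵢ(g) - χⱼ(g)‖ = 1` (`ker red = 𝔪`); and `red P = ∏ᵢ (X - χ̄ᵢ(g))` for every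
`P ∈ 𝒪[X]` lifting `det(X - ρ(g))` (triangular characteristic polynomial).  Stated as an existence
to keep the file free of definitions. [folklore] -/
theorem exists_redDiagChar [CompactSpace G] [CharP k p] (red : Valued.integer (PadicAlgCl p) →+* k)
    {ρ : FramedRep G (PadicAlgCl p) n} (h : ρ.IsUpperTriangular) :
    ∃ χ : Fin n → G →* kˣ,
      (∀ (i : Fin n) (g : G) (x : Valued.integer (PadicAlgCl p)),
        (x : PadicAlgCl p) = ρ.diagEntry i g → ((χ i g : kˣ) : k) = red x) ∧
      (∀ (i j : Fin n) (g : G), χ i g ≠ χ j g ↔ ‖ρ.diagEntry i g - ρ.diagEntry j g‖ = 1) ∧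
      ∀ (g : G) (P : Polynomial (Valued.integer (PadicAlgCl p))),
        P.map (Valued.integer (PadicAlgCl p)).subtype = ρ.charpoly g →
        P.map red = ∏ i, (X - C ((χ i g : kˣ) : k)) := by
  -- `χᵢ` with values in `𝒪`, as monoid homomorphisms
  let ι : Fin n → G →* Valued.integer (PadicAlgCl p) := fun i =>
    { toFun := fun g =>
        ⟨ρ.diagEntry i g, PadicAlgCl.mem_integer_of_norm_le_one (h.norm_diagEntry_eq_one i g).le⟩
      map_one' := Subtype.ext (ρ.diagEntry_one i)
      map_mul' := fun g g' => Subtype.ext (h.diagEntry_mul i g g') }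
  have hι : ∀ i g, ((ι i g : Valued.integer (PadicAlgCl p)) : PadicAlgCl p) = ρ.diagEntry i g :=
    fun i g => rfl
  refine ⟨fun i => (red.toMonoidHom.comp (ι i)).toHomUnits, fun i g x hx => ?_, fun i j g => ?_,
    fun g P hP => ?_⟩
  · rw [show x = ι i g from Subtype.ext (hx.trans (hι i g).symm)]
    rfl
  · rw [h.norm_diagEntry_sub_eq_one_iff, Ne, ← Units.val_inj, ← hι, ← hι, ← red_eq_red_iff red]
    rfl
  · have hQ : P = ∏ i, (X - C (ι i g)) := by
      apply Polynomial.map_injective (Valued.integer (PadicAlgCl p)).subtype Subtype.val_injective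
      rw [hP, Polynomial.map_prod, FramedRep.charpoly, Matrix.charpoly_of_upperTriangular _
        ((FramedRep.isUpperTriangular_iff_blockTriangular ρ).1 h g)]
      simp only [Polynomial.map_sub, Polynomial.map_X, Polynomial.map_C]
      rfl
    rw [hQ, Polynomial.map_prod]
    simp only [Polynomial.map_sub, Polynomial.map_X, Polynomial.map_C]
    rfl

end RedChar

section Place

variable (p : ℕ) [Fact p.Prime] (v : HeightOneSpectrum (𝓞 ℚ))

/-- A place `v` of `ℚ` containing the rational prime `p` is THE place above `p`:
`primesEquiv v = p`. [folklore] -/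
theorem primesEquiv_eq_of_natCast_mem (hv : ((p : ℕ) : 𝓞 ℚ) ∈ v.asIdeal) :
    (Rat.HeightOneSpectrum.primesEquiv v : ℕ) = p := by
  have h : Rat.HeightOneSpectrum.natGenerator v ∣ p := by
    rw [Rat.HeightOneSpectrum.natGenerator_dvd_iff]
    have := Ideal.mem_map_of_mem (Rat.IsIntegralClosure.intEquiv (𝓞 ℚ)) hv
    rwa [map_natCast] at this
  exact (Nat.prime_dvd_prime_iff_eq (Rat.HeightOneSpectrum.prime_natGenerator v) Fact.out).1 h

/-- The route's inertial diagonal value `ι((ε σ)⁻¹)^c` at an inertia element with `ε(σ) = -1` is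
`(-1)^c`. [folklore] -/
theorem algebraMap_inv_neg_one_pow (c : ℕ) :
    algebraMap ℚ_[p] (PadicAlgCl p) ((((-1 : ℤ_[p]ˣ)⁻¹ : ℤ_[p]ˣ) : ℤ_[p]) : ℚ_[p]) ^ c = (-1) ^ c := by
  rw [inv_neg_one, Units.val_neg, Units.val_one, PadicInt.coe_neg, PadicInt.coe_one, map_neg, map_one]

end Place

/-- **Stub 1b (`stub_distinguishedTransferLocal`).**  Let `p` be odd, `v ∣ p`, and
`r, r' : Γ_ℚ → GL₄(ℚ̄_p)` with congruent characteristic polynomials everywhere (conclusion of Stub 1a).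
If `r` is residually distinguished of shape `(0,0,1,1)` at `v` and `r'` is Greenberg-ordinary of shape
`(0,0,1,1)` at `v`, then `r'` is residually distinguished of shape `(0,0,1,1)` at `v` (in its Greenberg
frame): the residual diagonal characters of the two frames have equal `∏(X - ·(τ))` for all
`τ ∈ Γ_{ℚ_v}`, hence equal multiplicities (Brauer–Nesbitt), and an inertia element with `ε = -1`
keeps the weight-`0` and weight-`1` indices apart, so `χ̄₀ ≠ χ̄₁`, `χ̄₂ ≠ χ̄₃` transfer.
[cite: BoxerEtAl2021, §7.3 (p-distinguished); BourbakiAlgebreVIII2012, VIII § 20 n° 6, Cor. 1] -/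
theorem stub_distinguishedTransferLocal :
    ∀ (p : ℕ) [Fact p.Prime], p ≠ 2 → ∀ (k : Type) [Field k] [CharP k p]
      (red : Valued.integer (PadicAlgCl p) →+* k)
      (r r' : FramedGaloisRep ℚ (PadicAlgCl p) 4) (v : HeightOneSpectrum (𝓞 ℚ)),
      ((p : ℕ) : 𝓞 ℚ) ∈ v.asIdeal →
      (∀ τ : Field.absoluteGaloisGroup ℚ,
        ∃ P P' : Polynomial (Valued.integer (PadicAlgCl p)),
          P.map (Valued.integer (PadicAlgCl p)).subtype = FramedRep.charpoly r τ ∧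
          P'.map (Valued.integer (PadicAlgCl p)).subtype = FramedRep.charpoly r' τ ∧
          P.map red = P'.map red) →
      r.IsResiduallyDistinguishedAt v ![0, 0, 1, 1] →
      r'.IsGreenbergOrdinaryOfShapeAt v ![0, 0, 1, 1] →
      r'.IsResiduallyDistinguishedAt v ![0, 0, 1, 1] := by
  intro p _ hp k _ _ red r r' v hv hcong hdist hGr
  haveI : CompactSpace (Field.absoluteGaloisGroup (v.adicCompletion ℚ)) :=
    absoluteGaloisGroup_compactSpace _
  rw [FramedGaloisRep.IsResiduallyDistinguishedAt,
    FramedRep.isResiduallyDistinguishedOfShape_iff_conj] at hdist ⊢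
  rw [FramedGaloisRep.isGreenbergOrdinaryOfShapeAt_iff,
    FramedRep.isGreenbergOrdinaryOfShape_iff_conj] at hGr
  obtain ⟨g, htri, hdiag, hsep⟩ := hdist
  obtain ⟨g', htri', hdiag', -⟩ := hGr
  refine ⟨g', htri', hdiag', ?_⟩
  -- the residual diagonal characters `a = χ̄` of the frame `g` and `b = ψ̄` of the frame `g'`
  obtain ⟨a, ha, hane, hapr⟩ := exists_redDiagChar red htri
  obtain ⟨b, hb, hbne, hbpr⟩ := exists_redDiagChar red htri'
  -- (1) equal residual characteristic polynomials on `Γ_{ℚ_v}`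
  have hprod : ∀ τ, ∏ i, (X - C ((a i τ : kˣ) : k)) = ∏ i, (X - C ((b i τ : kˣ) : k)) := fun τ => by
    obtain ⟨P, P', hP, hP', hPP'⟩ := hcong (absGaloisRestrict ℚ (v.adicCompletion ℚ) τ)
    rw [← hapr τ P (by rw [hP, charpoly_conj_aux]; rfl), ← hbpr τ P' (by rw [hP', charpoly_conj_aux]; rfl),
      hPP']
  -- (2) Brauer–Nesbitt: equal multiplicities of residual characters
  have hcard := card_filter_eq_of_prod_X_sub_C_eq a b hprod
  -- (3) an inertia element with `ε = -1` separates the weights `0` and `1`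
  obtain ⟨σ₀, hσ₀I, hσ₀⟩ := adicCompletion_rat_exists_mem_absInertia_cyclotomicCharacter_eq p v
    (primesEquiv_eq_of_natCast_mem p v hv) (-1)
  have hval : ∀ {ρ : FramedRep (Field.absoluteGaloisGroup (v.adicCompletion ℚ)) (PadicAlgCl p) 4}
      {c : Fin 4 → Field.absoluteGaloisGroup (v.adicCompletion ℚ) →* kˣ},
      (∀ (i : Fin 4) τ (x : Valued.integer (PadicAlgCl p)),
        (x : PadicAlgCl p) = ρ.diagEntry i τ → ((c i τ : kˣ) : k) = red x) →
      (∀ τ ∈ absInertia (v.adicCompletion ℚ), ∀ i : Fin 4, ρ.diagEntry i τ =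
        algebraMap ℚ_[p] (PadicAlgCl p)
          ((((GaloisRep.cyclotomicCharacter (v.adicCompletion ℚ) p τ)⁻¹ : ℤ_[p]ˣ) : ℤ_[p]) :
            ℚ_[p]) ^ (![0, 0, 1, 1] : Fin 4 → ℕ) i) →
      ∀ i, ((c i σ₀ : kˣ) : k) = (-1) ^ (![0, 0, 1, 1] : Fin 4 → ℕ) i := by
    intro ρ c hc hd i
    rw [hc i σ₀ ((-1) ^ (![0, 0, 1, 1] : Fin 4 → ℕ) i)
      (by push_cast; rw [hd σ₀ hσ₀I i, hσ₀, algebraMap_inv_neg_one_pow]), map_pow, map_neg, map_one]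
  have hu : (-1 : k) ≠ 1 := Ring.neg_one_ne_one_of_char_ne_two (by rw [ringChar.eq k p]; exact hp)
  -- (4) `r` is distinguished: `a₀ ≠ a₁`, `a₂ ≠ a₃`; transfer to `b`
  have hne : ∀ i j : Fin 4, (∃ τ, ‖((r.toLocal v).conj g).diagEntry i τ -
      ((r.toLocal v).conj g).diagEntry j τ‖ = 1) → a i ≠ a j := by
    rintro i j ⟨τ, hτ⟩ hij
    exact (hane i j τ).2 hτ (DFunLike.congr_fun hij τ)
  obtain ⟨hb01, hb23⟩ := ne_and_ne_of_card_filter_eq a b hcard hu (hval ha hdiag)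
    (hval hb hdiag') (hne 0 1 (hsep 0 1 (by decide) (by decide)))
    (hne 2 3 (hsep 2 3 (by decide) (by decide)))
  -- (5) conclusion in the Greenberg frame
  have hwit : ∀ i j : Fin 4, b i ≠ b j →
      ∃ τ, ‖((r'.toLocal v).conj g').diagEntry i τ - ((r'.toLocal v).conj g').diagEntry j τ‖ = 1 := by
    intro i j hij
    by_contra hcon
    refine hij (MonoidHom.ext fun τ => ?_)
    by_contra hτ
    exact hcon ⟨τ, (hbne i j τ).1 hτ⟩
  intro i j hij haij
  rcases (shape0011_eq_iff i j hij).1 haij with ⟨rfl, rfl⟩ | ⟨rfl, rfl⟩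
  exacts [hwit 0 1 hb01, hwit 2 3 hb23]

end Summit.Langlands.Langlands.Cruxes.StableYoshidaCongruence.LevelThreeWeierstrassSwitch

end
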